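import Literature.NumberTheory.LocalFields.RamifiedQuadraticNormCriterion    -- ★ B-p10 (g26): `RamifiedQuadraticNorm.ringChar_residueField_ne_two` (tame ⇒ odd residue characteristic)
import Mathlib.NumberTheory.LegendreSymbol.QuadraticChar.Basic
import HarnessLib

/-!
# (R1-ram, R5b-σ) SIGN COHERENCE ALONG THE TORUS: the Δ-side residue sign times the D-side bit sign is `t`-FREE
# (Labesse–Langlands 1979 §2 p. 9; Rogawski 1990 Lemma 4.9.3; road «R1-ram», (R5b-β) assembler F0P3a-p03 (g12) deal 10:36:43Z, designer B-p12 (g29) MEMO (R5b-α) (6)∕(6′))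

Topic `NumberTheory/Rogawski1990`; namespace `Literature.NumberTheory.Rogawski1990`.  THEOREMS ONLY (no definition, no instance, no notation, no named fact, no `sorry`).
Cell `pub/hodgecm-mathlib` (D-0151), crux H413 = `stmt-HodgeConjecture-24833`, line «N6nsGerm» stub `stub_N6nsR1LL`, residue ★ `RankOneUnstableTransferNonsplitCMERamified` ⟸ ★ p843417 ⟸
★ p843587 `rankOneUnstable_core_of_signedWindow` (the (R5b-β) fold), whose binders `hD`∕`hΔ` carry two SIGNS at a regular torus point `t` (`a = τ₀ t`, `c = τ₁ t`, `a − c = π^N u`):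
the Δ-side residue sign of the Cayley parameter `β₀ = u ∕ (2 c g)` (★ B-p10 R-4∕R-4b: `μ_v(a − c)⁻¹·√(∏‖·‖) = … · (β₀, θ)_v`, `θ_v = π g²`, tame evaluation `χ(β̄₀)`) and the
D-side bit `ε₀(t) = s₀·χ(c̄ ū θ̄₀)` (★ B-p12 FILE 5 `normalForm_bit_iff_of_eigenline`: `e = 0 ↔ IsSquare (residue S)`, `S = (−1)^{(N+i)∕2+1}·c·u·θ₀`).  B-p12 (6′): their PRODUCT is
`χ(ū)²·χ(c̄)²·χ(2 ḡ θ̄₀)·s₀^{…} = χ(2 ḡ θ̄₀)·s₀^{…}` — INDEPENDENT of `t`.  HONEST LABEL: HC_CM is proved only modulo the printed citations (hLiu418, h413) until rung 0 closes;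
this file is finite-field algebra.

* §1 (finite field `k`, odd characteristic) `ite_isSquare_eq_intCast_quadraticChar` (the `±1` sign IS the quadratic character), **`ite_isSquare_mul_ite_isSquare_eq_of_mul_eq`**
  (`β·(t₂ c g) = u`, all non-zero ⇒ `[β]·[c u θ] = [t₂ g θ]`, `[x] := if IsSquare x then 1 else −1`), `ite_isSquare_neg_one_pow_mul` (`[(−1)^n x] = [−1]^n · [x]`), and the
  decorated product `ite_isSquare_mul_ite_isSquare_neg_one_pow_mul_eq_of_mul_eq`.
* §2 (valuation ring `𝒪[F]`, `[ValuativeRel F]`, finite residue field, `2 ∈ 𝒪ˣ`) the same three through `IsLocalRing.residue` for UNITS `u c g θ` and `β` with `β·(2 c g) = u`: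
  **`ite_isSquare_residue_mul_eq_of_mul_eq`**, **`ite_isSquare_residue_mul_neg_one_pow_eq_of_mul_eq`** — the (R5b-σ) identity in the tokens of ★ R-4b and ★ FILE 5.
* §3 (ED. 2) the CAYLEY RELATION `cayley_unitPart_mul_eq` (field identity `β·((a∕c+1)·c·g) = u` from ★ R-4's `ι_w b₀ = (z−1)∕((z+1)α)`, `α = ϖ g`, `ι_w b₀ = ϖ^{2k} β`,
  `a − c = ϖ^{2k+1} u`), `residue_eq_two_of_sub_one_mem`, and **`ite_isSquare_residue_mul_neg_one_pow_eq_of_cayley`** (the joint sign identity with the Cayley denominator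
  `z + 1 ≡ 2` in place of `2`).

## References
* [LabesseLanglands1979] J.-P. Labesse, R. P. Langlands, *L-indistinguishability for SL(2)*, Canad. J. Math. 31 (1979): §2 p. 9 (the ramified κ-orbital integral).
* [Rogawski1990] J. D. Rogawski, *Automorphic Representations of Unitary Groups in Three Variables*, Ann. of Math. Stud. 123 (1990): §4.9 Lemma 4.9.3 (4.9.2) p. 56.
* [Serre1979] J.-P. Serre, *Local Fields*, GTM 67 (1979): Ch. V §3 (units modulo norms at a tamely ramified place); [IrelandRosen1990] K. Ireland, M. Rosen, *A Classical
  Introduction to Modern Number Theory* (1990): Ch. 5 §1 (the quadratic character is multiplicative).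
-/

set_option autoImplicit false

noncomputable section

open IsLocalRing
open scoped ValuativeRel

namespace Literature.NumberTheory.Rogawski1990

/-! ## §1 Finite-field core: signs are quadratic characters, and `χ(u)² = χ(c)² = 1` -/

section Core

variable {k : Type*} [Field k] [Fintype k] [DecidableEq k]

/-- For `a ≠ 0` in a finite field the sign `[IsSquare a] ∈ {±1} ⊂ ℂ` is the quadratic character `χ(a)` (Mathlib `quadraticChar`).
[cite: IrelandRosen1990, Ch. 5 §1] -/
theorem ite_isSquare_eq_intCast_quadraticChar {a : k} (ha : a ≠ 0) :
    (if IsSquare a then (1 : ℂ) else -1) = ((quadraticChar k a : ℤ) : ℂ) := by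
  by_cases h : IsSquare a
  · rw [if_pos h, (quadraticChar_one_iff_isSquare ha).2 h, Int.cast_one]
  · rw [if_neg h, quadraticChar_neg_one_iff_not_isSquare.2 h, Int.cast_neg, Int.cast_one]

/-- **SIGN COHERENCE (finite-field core).**  In a finite field of odd characteristic, if `β · (t₂ · c · g) = u` with `u, c, g, θ, t₂` non-zero, then
`[β] · [c·u·θ] = [t₂·g·θ]` for the signs `[x] := if IsSquare x then 1 else −1` — the quadratic character is multiplicative and `χ(u)² = χ(c)² = 1`: the `t`-dependent units
`u, c` CANCEL.  (Cayley parameter `β = β̄₀ = ū∕(2c̄ḡ)` of ★ R-4b against the bit argument `c̄ūθ̄₀` of ★ FILE 5.) [cite: LabesseLanglands1979, §2 p. 9] [cite: IrelandRosen1990, Ch. 5 §1] -/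
theorem ite_isSquare_mul_ite_isSquare_eq_of_mul_eq (hk : ringChar k ≠ 2) {β u c g θ t₂ : k}
    (hβ : β * (t₂ * c * g) = u) (hu : u ≠ 0) (hc : c ≠ 0) (hg : g ≠ 0) (hθ : θ ≠ 0) (h2 : t₂ ≠ 0) :
    (if IsSquare β then (1 : ℂ) else -1) * (if IsSquare (c * u * θ) then 1 else -1) = (if IsSquare (t₂ * g * θ) then 1 else -1) := by
  have _ := hk
  have hβ0 : β ≠ 0 := by
    rintro rfl
    rw [zero_mul] at hβ
    exact hu hβ.symm
  rw [ite_isSquare_eq_intCast_quadraticChar hβ0, ite_isSquare_eq_intCast_quadraticChar (mul_ne_zero (mul_ne_zero hc hu) hθ),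
    ite_isSquare_eq_intCast_quadraticChar (mul_ne_zero (mul_ne_zero h2 hg) hθ), ← Int.cast_mul]
  congr 1
  have e1 : quadraticChar k β * (quadraticChar k t₂ * quadraticChar k c * quadraticChar k g) = quadraticChar k u := by
    rw [← map_mul, ← map_mul, ← map_mul, hβ]
  have e2 : quadraticChar k u * quadraticChar k u = 1 := by rw [← sq, quadraticChar_sq_one hu]
  have e3 : quadraticChar k c * quadraticChar k c = 1 := by rw [← sq, quadraticChar_sq_one hc]
  have e4 : quadraticChar k t₂ * quadraticChar k t₂ = 1 := by rw [← sq, quadraticChar_sq_one h2]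
  have e5 : quadraticChar k g * quadraticChar k g = 1 := by rw [← sq, quadraticChar_sq_one hg]
  rw [map_mul, map_mul, map_mul, map_mul]
  linear_combination (quadraticChar k t₂ * quadraticChar k g * quadraticChar k u * quadraticChar k θ) * e1
    + (quadraticChar k t₂ * quadraticChar k g * quadraticChar k θ) * e2
    - (quadraticChar k β * quadraticChar k c * quadraticChar k u * quadraticChar k θ * (quadraticChar k g * quadraticChar k g)) * e4
    - (quadraticChar k β * quadraticChar k c * quadraticChar k u * quadraticChar k θ) * e5

/-- **The sign of `(−1)^n · a`**: `[(−1)^n a] = [−1]^n · [a]` for `a ≠ 0` (`χ` multiplicative; `[−1] = s₀ = χ(−1)`). [cite: IrelandRosen1990, Ch. 5 §1] -/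
theorem ite_isSquare_neg_one_pow_mul {a : k} (ha : a ≠ 0) (n : ℕ) :
    (if IsSquare ((-1 : k) ^ n * a) then (1 : ℂ) else -1) = (if IsSquare (-1 : k) then (1 : ℂ) else -1) ^ n * (if IsSquare a then 1 else -1) := by
  have hn1 : (-1 : k) ≠ 0 := neg_ne_zero.2 one_ne_zero
  rw [ite_isSquare_eq_intCast_quadraticChar (mul_ne_zero (pow_ne_zero n hn1) ha), ite_isSquare_eq_intCast_quadraticChar hn1,
    ite_isSquare_eq_intCast_quadraticChar ha, map_mul, map_pow, Int.cast_mul, Int.cast_pow]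

/-- **SIGN COHERENCE with the D-side sign power** (`S = (−1)^n·c·u·θ` as in ★ FILE 5): `[β] · [(−1)^n c u θ] = [−1]^n · [t₂ g θ]`. [cite: LabesseLanglands1979, §2 p. 9]
[cite: IrelandRosen1990, Ch. 5 §1] -/
theorem ite_isSquare_mul_ite_isSquare_neg_one_pow_mul_eq_of_mul_eq (hk : ringChar k ≠ 2) {β u c g θ t₂ : k}
    (hβ : β * (t₂ * c * g) = u) (hu : u ≠ 0) (hc : c ≠ 0) (hg : g ≠ 0) (hθ : θ ≠ 0) (h2 : t₂ ≠ 0) (n : ℕ) :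
    (if IsSquare β then (1 : ℂ) else -1) * (if IsSquare ((-1 : k) ^ n * (c * u * θ)) then 1 else -1) =
      (if IsSquare (-1 : k) then (1 : ℂ) else -1) ^ n * (if IsSquare (t₂ * g * θ) then 1 else -1) := by
  rw [ite_isSquare_neg_one_pow_mul (mul_ne_zero (mul_ne_zero hc hu) hθ), mul_left_comm,
    ite_isSquare_mul_ite_isSquare_eq_of_mul_eq hk hβ hu hc hg hθ h2]

end Core

/-! ## §2 The residue dress on a valuation ring `𝒪[F]` with finite residue field and `2 ∈ 𝒪ˣ` -/

section Residue

variable {F : Type*} [Field F] [ValuativeRel F] [Finite (ResidueField 𝒪[F])]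

open scoped Classical in
/-- **SIGN COHERENCE through `residue`**: for UNITS `u c g θ ∈ 𝒪` and `β ∈ 𝒪` with `β·(2·c·g) = u` (the Cayley relation of ★ R-4b in integral form), `2 ∈ 𝒪ˣ` (tame):
`[res β]·[res (c u θ)] = [res (2 g θ)]`. [cite: LabesseLanglands1979, §2 p. 9] [cite: Serre1979, Ch. V §3] -/
theorem ite_isSquare_residue_mul_eq_of_mul_eq (h2 : IsUnit (2 : 𝒪[F])) {β u c g θ : 𝒪[F]}
    (hβ : β * (2 * c * g) = u) (hu : IsUnit u) (hc : IsUnit c) (hg : IsUnit g) (hθ : IsUnit θ) :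
    (if IsSquare (residue 𝒪[F] β) then (1 : ℂ) else -1) * (if IsSquare (residue 𝒪[F] (c * u * θ)) then 1 else -1) =
      (if IsSquare (residue 𝒪[F] (2 * g * θ)) then 1 else -1) := by
  classical
  letI : Fintype (ResidueField 𝒪[F]) := Fintype.ofFinite _
  have hk := Literature.NumberTheory.LocalFields.RamifiedQuadraticNorm.ringChar_residueField_ne_two (R := 𝒪[F]) h2
  have hβ' : residue 𝒪[F] β * (residue 𝒪[F] 2 * residue 𝒪[F] c * residue 𝒪[F] g) = residue 𝒪[F] u := by
    rw [← map_mul, ← map_mul, ← map_mul, hβ]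
  have h := ite_isSquare_mul_ite_isSquare_eq_of_mul_eq hk hβ' ((residue_ne_zero_iff_isUnit _).2 hu) ((residue_ne_zero_iff_isUnit _).2 hc)
    ((residue_ne_zero_iff_isUnit _).2 hg) ((residue_ne_zero_iff_isUnit _).2 hθ) ((residue_ne_zero_iff_isUnit _).2 h2)
  rw [← map_mul, ← map_mul, ← map_mul, ← map_mul] at h
  convert h

open scoped Classical in
/-- **… with the D-side sign power** `(−1)^n`: `[res β]·[res ((−1)^n c u θ)] = [res (−1)]^n · [res (2 g θ)]`. [cite: LabesseLanglands1979, §2 p. 9] [cite: Serre1979, Ch. V §3] -/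
theorem ite_isSquare_residue_mul_neg_one_pow_eq_of_mul_eq (h2 : IsUnit (2 : 𝒪[F])) {β u c g θ : 𝒪[F]}
    (hβ : β * (2 * c * g) = u) (hu : IsUnit u) (hc : IsUnit c) (hg : IsUnit g) (hθ : IsUnit θ) (n : ℕ) :
    (if IsSquare (residue 𝒪[F] β) then (1 : ℂ) else -1) * (if IsSquare (residue 𝒪[F] ((-1) ^ n * (c * u * θ))) then 1 else -1) =
      (if IsSquare (residue 𝒪[F] (-1)) then (1 : ℂ) else -1) ^ n * (if IsSquare (residue 𝒪[F] (2 * g * θ)) then 1 else -1) := by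
  classical
  letI : Fintype (ResidueField 𝒪[F]) := Fintype.ofFinite _
  have hk := Literature.NumberTheory.LocalFields.RamifiedQuadraticNorm.ringChar_residueField_ne_two (R := 𝒪[F]) h2
  have hβ' : residue 𝒪[F] β * (residue 𝒪[F] 2 * residue 𝒪[F] c * residue 𝒪[F] g) = residue 𝒪[F] u := by
    rw [← map_mul, ← map_mul, ← map_mul, hβ]
  have h := ite_isSquare_mul_ite_isSquare_neg_one_pow_mul_eq_of_mul_eq hk hβ' ((residue_ne_zero_iff_isUnit _).2 hu) ((residue_ne_zero_iff_isUnit _).2 hc)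
    ((residue_ne_zero_iff_isUnit _).2 hg) ((residue_ne_zero_iff_isUnit _).2 hθ) ((residue_ne_zero_iff_isUnit _).2 h2) n
  rw [← map_mul, ← map_mul, ← map_mul, ← map_mul] at h
  have hn : residue 𝒪[F] ((-1) ^ n * (c * u * θ)) = (-1 : ResidueField 𝒪[F]) ^ n * residue 𝒪[F] (c * u * θ) := by
    rw [map_mul, map_pow, map_neg, map_one]
  have h1 : residue 𝒪[F] (-1) = (-1 : ResidueField 𝒪[F]) := by rw [map_neg, map_one]
  rw [← hn, ← h1] at h
  convert h

end Residue

/-! ## §3 (ED. 2) The integral CAYLEY RELATION behind (6′): `ι_w β₀ · ((z+1)·c·g) = u`, `(z+1)‾ = 2̄`, and the joint sign identity read in `𝓀_w` -/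

section Cayley

/-- **THE CAYLEY RELATION (field identity).**  In any field: if `x = (a∕c − 1) ∕ ((a∕c + 1)·α)` (★ R-4's `ι_w b₀`, `α = √θ_w`), `α = ϖ·g` (★ R-4b: `θ_v = π g²`, `ι_w π = ϖ²`),
`x = ϖ^(2k)·β` (unit part, `b₀ = π^k β₀`) and `a − c = ϖ^(2k+1)·u` (the D-side depth token, `N = 2k+1`), with `c, ϖ, g, a∕c + 1` non-zero, then **`β · ((a∕c + 1)·c·g) = u`** — so
`β̄₀ = ū ∕ (2 c̄ ḡ)` once `(a∕c + 1)‾ = 2̄` (B-p12 MEMO (R5b-α) (6′), B-p10 10:21:17Z (i)). [cite: LabesseLanglands1979, §2 p. 9] [cite: Rogawski1990, §4.9 p. 55] -/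
theorem cayley_unitPart_mul_eq {K : Type*} [Field K] {x a c α ϖ g β u : K} {k : ℕ}
    (hx : x = (a / c - 1) / ((a / c + 1) * α)) (hα : α = ϖ * g) (hxβ : x = ϖ ^ (2 * k) * β) (hu : a - c = ϖ ^ (2 * k + 1) * u)
    (hc : c ≠ 0) (hϖ : ϖ ≠ 0) (hg : g ≠ 0) (hz1 : a / c + 1 ≠ 0) :
    β * ((a / c + 1) * c * g) = u := by
  have hden : (a / c + 1) * α ≠ 0 := mul_ne_zero hz1 (by rw [hα]; exact mul_ne_zero hϖ hg)
  have h1 : x * ((a / c + 1) * α) = a / c - 1 := by rw [hx, div_mul_cancel₀ _ hden]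
  have h2 : a / c - 1 = (a - c) / c := by field_simp
  have hϖk : ϖ ^ (2 * k) ≠ 0 := pow_ne_zero _ hϖ
  -- `ϖ^(2k) β (a/c+1) ϖ g = ϖ^(2k+1) u / c`
  have h3 : ϖ ^ (2 * k) * (β * ((a / c + 1) * c * g) * ϖ) = ϖ ^ (2 * k) * (u * ϖ) := by
    have h4 : x * ((a / c + 1) * α) * c = a - c := by rw [h1, h2, div_mul_cancel₀ _ hc]
    rw [hxβ, hα, hu] at h4
    calc ϖ ^ (2 * k) * (β * ((a / c + 1) * c * g) * ϖ) = ϖ ^ (2 * k) * β * ((a / c + 1) * (ϖ * g)) * c := by ring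
      _ = ϖ ^ (2 * k + 1) * u := h4
      _ = ϖ ^ (2 * k) * (u * ϖ) := by ring
  have h5 := mul_left_cancel₀ hϖk h3
  exact mul_right_cancel₀ hϖ h5

variable {F : Type*} [Field F] [ValuativeRel F]

/-- **`(z + 1)‾ = 2̄`** in `𝓀 = 𝒪[F]∕𝔪` when `z − 1 ∈ 𝔪` (`z = a∕c` with `a ≡ c`): the Cayley denominator's residue. [cite: LabesseLanglands1979, §2 p. 9] -/
theorem residue_eq_two_of_sub_one_mem {z : 𝒪[F]} (hz : z - 1 ∈ IsLocalRing.maximalIdeal 𝒪[F]) : residue 𝒪[F] (z + 1) = residue 𝒪[F] 2 := by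
  rw [← sub_eq_zero, ← map_sub, residue_eq_zero_iff]
  convert hz using 1
  ring

open scoped Classical in
/-- **(R5b-σ) JOINT SIGN IDENTITY IN `𝓀_w`, FROM THE CAYLEY RELATION.**  `𝒪 = 𝒪[F]` with finite residue field and `2 ∈ 𝒪ˣ`; integral tokens `β, z₁ := z + 1, c, g, u, θ` with
`β·(z₁·c·g) = u` (the Cayley relation, e.g. from `cayley_unitPart_mul_eq` read in `𝒪`), `z₁ − 2 ∈ 𝔪` (i.e. `z − 1 ∈ 𝔪`), `c, g, u, θ` units: for every `n`,
**`[res β] · [res ((−1)^n · (c·u·θ))] = [res (−1)]^n · [res (2·g·θ)]`** (`[x] := if IsSquare x then 1 else −1`) — the Δ-side bit times the D-side bit is `s₀^n·[2 g θ₀]`, `t`-FREE.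
[cite: LabesseLanglands1979, §2 p. 9] [cite: Serre1979, Ch. V §3] -/
theorem ite_isSquare_residue_mul_neg_one_pow_eq_of_cayley [Finite (ResidueField 𝒪[F])] (h2 : IsUnit (2 : 𝒪[F])) {β z₁ u c g θ : 𝒪[F]}
    (hβ : β * (z₁ * c * g) = u) (hz₁ : z₁ - 2 ∈ IsLocalRing.maximalIdeal 𝒪[F]) (hu : IsUnit u) (hc : IsUnit c) (hg : IsUnit g) (hθ : IsUnit θ) (n : ℕ) :
    (if IsSquare (residue 𝒪[F] β) then (1 : ℂ) else -1) * (if IsSquare (residue 𝒪[F] ((-1) ^ n * (c * u * θ))) then 1 else -1) =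
      (if IsSquare (residue 𝒪[F] (-1)) then (1 : ℂ) else -1) ^ n * (if IsSquare (residue 𝒪[F] (2 * g * θ)) then 1 else -1) := by
  classical
  letI : Fintype (ResidueField 𝒪[F]) := Fintype.ofFinite _
  have hk := Literature.NumberTheory.LocalFields.RamifiedQuadraticNorm.ringChar_residueField_ne_two (R := 𝒪[F]) h2
  have hz2 : residue 𝒪[F] z₁ = residue 𝒪[F] 2 := by
    rw [← sub_eq_zero, ← map_sub, residue_eq_zero_iff]; exact hz₁
  have hβ' : residue 𝒪[F] β * (residue 𝒪[F] 2 * residue 𝒪[F] c * residue 𝒪[F] g) = residue 𝒪[F] u := by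
    rw [← hz2, ← map_mul, ← map_mul, ← map_mul, hβ]
  have h := ite_isSquare_mul_ite_isSquare_neg_one_pow_mul_eq_of_mul_eq hk hβ' ((residue_ne_zero_iff_isUnit _).2 hu) ((residue_ne_zero_iff_isUnit _).2 hc)
    ((residue_ne_zero_iff_isUnit _).2 hg) ((residue_ne_zero_iff_isUnit _).2 hθ) ((residue_ne_zero_iff_isUnit _).2 h2) n
  rw [← map_mul, ← map_mul, ← map_mul, ← map_mul] at h
  have hn : residue 𝒪[F] ((-1) ^ n * (c * u * θ)) = (-1 : ResidueField 𝒪[F]) ^ n * residue 𝒪[F] (c * u * θ) := by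
    rw [map_mul, map_pow, map_neg, map_one]
  have h1 : residue 𝒪[F] (-1) = (-1 : ResidueField 𝒪[F]) := by rw [map_neg, map_one]
  rw [← hn, ← h1] at h
  convert h

end Cayley

end Literature.NumberTheory.Rogawski1990

end
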